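import Mathlib
import Summits.Ventures.PercRepro.TriangleCapSevenElevenG
import Summits.Ventures.PercRepro.TriangleCapSevenElevenD
import Summits.Ventures.PercRepro.TriangleCapOneTriangleSeven
import Summits.Ventures.PercRepro.TriangleCapDenseStabilityEight

/-!
# PercRepro — THE CELL `(7, 11)` IS EXACT, AND EVERY CELL ONE BELOW THE DIAGONAL OF THE DENSE CORNER IS
EXACT FOR EVERY `k ≥ 7` (p3, gen 35; part 35n)

* `stability_of_triangle_bounds_seven'` — the chain at `k = 7` in the form `30 ≤ |T₃| + 2·Σ|outer| + 3·Σ₀`;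
* **`third_triangle_bound`** — three triangles, the third with a vertex off the first two, `m ≥ 11`:
  `12 ≤ 2·Σ_{T₃}|outer| + 3·Σ_{codeg = 0} deficit` (an outer vertex of any triangle, or configuration α / β);
* **`cell_seven_eleven_stability`** — a `K₄⁻`-free graph on `7` vertices with `m ≥ 11` edges that is not
  complete bipartite spanning has `Σ_v d(v)² + 5 ≤ 7m` (triangle-free: Mantel's stability; one triangle:
  `one_triangle_stability_seven`; two: `stability_two_triangles_seven`; three: `third_triangle_bound` with
  `|T₃| ≥ 18`);
* **`cell_seven_eleven`** — the `K₄⁻`-free cherry maximum with `11` edges on `7` vertices is `25`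
  (`2 · 25 = 50`), by `K_{3,4}` minus an edge — the last census-only cell of the dense corner below `k = 8`;
* **`one_below_diagonal_exact_seven`** — for every `k ≥ 7` the cells one below the diagonal are exact.

Axioms: standard.
-/

namespace PercRepro

namespace TriangleCap

namespace C047

open Finset

variable {V : Type*} [Fintype V] [DecidableEq V]

/-- The chain at `k = 7`: `30 ≤ |T₃| + 2·Σ_{T₃}|outer| + 3·Σ_{codeg = 0} deficit` gives `Σ_v d(v)² + 5 ≤ 7m`. -/
theorem stability_of_triangle_bounds_seven' (D : SimpleGraph V) [DecidableRel D.Adj] (hK : K4mFree D)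
    (hk : Fintype.card V = 7)
    (h : 30 ≤ (triangles3 D).card + 2 * ∑ t ∈ triangles3 D, (outer D t.1.1 t.1.2 t.2).card +
      3 * ∑ p ∈ adjPairsAll D, (if codeg D p = 0 then deficit D p else 0)) :
    ∑ v, deg D v * deg D v + (Fintype.card V - 2) ≤ D.edgeFinset.card * Fintype.card V := by
  have hid := two_mul_sum_deg_sq_add_sum_deficit D
  have hsplit := sum_deficit_split D hK
  have hrot := card_mul_add_two_mul_sum_outer_le D hK
  rw [hk] at hrot hid ⊢
  rw [hsplit] at hid
  generalize hS : ∑ v, deg D v * deg D v = S at hid ⊢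
  generalize hA : ∑ t ∈ triangles3 D, deficit D t.1 = A at hid hrot
  generalize hB : ∑ p ∈ adjPairsAll D, (if codeg D p = 0 then deficit D p else 0) = B at hid h
  generalize hQ : ∑ t ∈ triangles3 D, (outer D t.1.1 t.1.2 t.2).card = Q at hrot h
  generalize hTT : (triangles3 D).card = T at hid hrot h
  generalize hM : D.edgeFinset.card = M at hid ⊢
  omega

/-- **THE THREE-TRIANGLE CASE AT `(7, 11)`:** `12 ≤ 2·Σ_{T₃}|outer| + 3·Σ_{codeg = 0} deficit`. -/
theorem third_triangle_bound (D : SimpleGraph V) [DecidableRel D.Adj] (hK : K4mFree D)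
    (hk : Fintype.card V = 7) (hm : 11 ≤ D.edgeFinset.card) {u v w a b c x y z : V}
    (huv : D.Adj u v) (huw : D.Adj u w) (hvw : D.Adj v w) (hab : D.Adj a b) (hac : D.Adj a c)
    (hbc : D.Adj b c) (ha : ¬ (a = u ∨ a = v ∨ a = w)) (hxy : D.Adj x y) (hxz : D.Adj x z)
    (hyz : D.Adj y z) (hx : ¬ (x = u ∨ x = v ∨ x = w ∨ x = a ∨ x = b ∨ x = c)) :
    12 ≤ 2 * ∑ t ∈ triangles3 D, (outer D t.1.1 t.1.2 t.2).card +
      3 * ∑ p ∈ adjPairsAll D, (if codeg D p = 0 then deficit D p else 0) := by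
  by_cases hO1 : outer D u v w = ∅
  · by_cases hO2 : outer D a b c = ∅
    · by_cases hO3 : outer D x y z = ∅
      · suffices h : 4 ≤ ∑ p ∈ adjPairsAll D, (if codeg D p = 0 then deficit D p else 0) by omega
        have hx1 : ¬ (x = u ∨ x = v ∨ x = w) := fun h => hx (or6_of_or3_left h)
        have hx2 : ¬ (x = a ∨ x = b ∨ x = c) := fun h => hx (or6_of_or3_right h)
        have hne : ∃ t, (t = a ∨ t = b ∨ t = c) ∧ ¬ (t = u ∨ t = v ∨ t = w) := ⟨a, by simp, ha⟩
        have hne' : ∃ t, (t = u ∨ t = v ∨ t = w) ∧ ¬ (t = a ∨ t = b ∨ t = c) := by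
          by_contra hall
          have hu2 : u = a ∨ u = b ∨ u = c := by
            by_contra h; exact hall ⟨u, by simp, h⟩
          have hv2 : v = a ∨ v = b ∨ v = c := by
            by_contra h; exact hall ⟨v, by simp, h⟩
          have hw2 : w = a ∨ w = b ∨ w = c := by
            by_contra h; exact hall ⟨w, by simp, h⟩
          exact ha (three_of_three hu2 hv2 hw2 huv.ne huw.ne hvw.ne).1
        have hyz' := hyz.ne
        by_cases hy1 : y = u ∨ y = v ∨ y = w
        · by_cases hz1 : z = u ∨ z = v ∨ z = w
          · exact (not_adj_two_of_triangle D hK huv huw hvw hx1 hy1 hz1 hyz' hxy hxz).elim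
          by_cases hz2 : z = a ∨ z = b ∨ z = c
          · exact alpha_bound D hK hk huv huw hvw hab hac hbc hxy hxz hyz hx1 hx2 hy1 hz2 hO2
          · exact beta_bound D hK hk hm huv huw hvw hab hac hbc hxy hxz hyz hx1 hx2 hz1 hz2 hy1 hne hO2
        · by_cases hy2 : y = a ∨ y = b ∨ y = c
          · by_cases hz2 : z = a ∨ z = b ∨ z = c
            · exact (not_adj_two_of_triangle D hK hab hac hbc hx2 hy2 hz2 hyz' hxy hxz).elim
            by_cases hz1 : z = u ∨ z = v ∨ z = w
            · exact alpha_bound D hK hk hab hac hbc huv huw hvw hxy hxz hyz hx2 hx1 hy2 hz1 hO1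
            · exact beta_bound D hK hk hm hab hac hbc huv huw hvw hxy hxz hyz hx2 hx1 hz2 hz1 hy2 hne' hO1
          · by_cases hz1 : z = u ∨ z = v ∨ z = w
            · exact beta_bound D hK hk hm huv huw hvw hab hac hbc hxz hxy hyz.symm hx1 hx2 hy1 hy2 hz1 hne hO2
            by_cases hz2 : z = a ∨ z = b ∨ z = c
            · exact beta_bound D hK hk hm hab hac hbc huv huw hvw hxz hxy hyz.symm hx2 hx1 hy2 hy1 hz2 hne'
                hO1
            · -- `x, y, z` off both triangles: eight vertices
              exfalso
              have hxy' := hxy.ne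
              have hxz' := hxz.ne
              simp only [not_or] at hx1 hx2 hy1 hy2 hz1 hz2 ha
              by_cases hb1 : b = u ∨ b = v ∨ b = w
              · have hc1 : ¬ (c = u ∨ c = v ∨ c = w) := fun hc1 =>
                  shared_unique D hK huv huw hvw hab hac hbc hne hb1 (by simp) hc1 (by simp) hbc.ne
                simp only [not_or] at hc1
                apply not_eight hk (v₁ := u) (v₂ := v) (v₃ := w) (v₄ := a) (v₅ := c) (v₆ := x) (v₇ := y)
                  (v₈ := z)
                rw [card_insert_of_notMem, card_insert_of_notMem, card_insert_of_notMem,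
                  card_insert_of_notMem, card_insert_of_notMem, card_insert_of_notMem,
                  card_insert_of_notMem, card_singleton]
                all_goals simp [huv.ne, huw.ne, hvw.ne, hac.ne, hxy', hxz', hyz', Ne.symm ha.1,
                  Ne.symm ha.2.1, Ne.symm ha.2.2, Ne.symm hc1.1, Ne.symm hc1.2.1, Ne.symm hc1.2.2,
                  Ne.symm hx1.1, Ne.symm hx1.2.1, Ne.symm hx1.2.2, Ne.symm hx2.1, Ne.symm hx2.2.2,
                  Ne.symm hy1.1, Ne.symm hy1.2.1, Ne.symm hy1.2.2, Ne.symm hy2.1, Ne.symm hy2.2.2,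
                  Ne.symm hz1.1, Ne.symm hz1.2.1, Ne.symm hz1.2.2, Ne.symm hz2.1, Ne.symm hz2.2.2]
              · simp only [not_or] at hb1
                apply not_eight hk (v₁ := u) (v₂ := v) (v₃ := w) (v₄ := a) (v₅ := b) (v₆ := x) (v₇ := y)
                  (v₈ := z)
                rw [card_insert_of_notMem, card_insert_of_notMem, card_insert_of_notMem,
                  card_insert_of_notMem, card_insert_of_notMem, card_insert_of_notMem,
                  card_insert_of_notMem, card_singleton]
                all_goals simp [huv.ne, huw.ne, hvw.ne, hab.ne, hxy', hxz', hyz', Ne.symm ha.1,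
                  Ne.symm ha.2.1, Ne.symm ha.2.2, Ne.symm hb1.1, Ne.symm hb1.2.1, Ne.symm hb1.2.2,
                  Ne.symm hx1.1, Ne.symm hx1.2.1, Ne.symm hx1.2.2, Ne.symm hx2.1, Ne.symm hx2.2.1,
                  Ne.symm hy1.1, Ne.symm hy1.2.1, Ne.symm hy1.2.2, Ne.symm hy2.1, Ne.symm hy2.2.1,
                  Ne.symm hz1.1, Ne.symm hz1.2.1, Ne.symm hz1.2.2, Ne.symm hz2.1, Ne.symm hz2.2.1]
      · obtain ⟨t, ht⟩ := nonempty_iff_ne_empty.mpr hO3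
        have := six_le_sum_outer D hxy hxz hyz ht
        omega
    · obtain ⟨t, ht⟩ := nonempty_iff_ne_empty.mpr hO2
      have := six_le_sum_outer D hab hac hbc ht
      omega
  · obtain ⟨t, ht⟩ := nonempty_iff_ne_empty.mpr hO1
    have := six_le_sum_outer D huv huw hvw ht
    omega

/-- **THE STABILITY AT `(7, 11)`:** a `K₄⁻`-free graph on `7` vertices with `m ≥ 11` edges that is not
complete bipartite spanning has `Σ_v d(v)² + 5 ≤ 7m`. -/
theorem cell_seven_eleven_stability (D : SimpleGraph V) [DecidableRel D.Adj] (hK : K4mFree D)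
    (hk : Fintype.card V = 7) (hm : 2 * Fintype.card V ≤ D.edgeFinset.card + 3)
    (hnot : ¬ ∃ A : Finset V, ∀ x y, D.Adj x y ↔ Xor (x ∈ A) (y ∈ A)) :
    ∑ v, deg D v * deg D v + (Fintype.card V - 2) ≤ D.edgeFinset.card * Fintype.card V := by
  by_cases hfree : D.CliqueFree 3
  · exact mantel_stability D hfree hnot
  · obtain ⟨S, hS⟩ := not_forall.mp hfree
    have hS' := not_not.mp hS
    rw [SimpleGraph.is3Clique_iff] at hS'
    obtain ⟨u, v, w, huv, huw, hvw, -⟩ := hS'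
    by_cases hT : ∀ a b c, D.Adj a b → D.Adj a c → D.Adj b c → a = u ∨ a = v ∨ a = w
    · exact one_triangle_stability_seven D hK hk huv huw hvw hT hm
    · simp only [not_forall, not_or] at hT
      obtain ⟨a, b, c, hab, hac, hbc, hau, hav, haw⟩ := hT
      have ha : ¬ (a = u ∨ a = v ∨ a = w) := by
        rintro (h | h | h)
        · exact hau h
        · exact hav h
        · exact haw h
      by_cases h3 : ∃ x y z, D.Adj x y ∧ D.Adj x z ∧ D.Adj y z ∧
          ¬ (x = u ∨ x = v ∨ x = w ∨ x = a ∨ x = b ∨ x = c)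
      · obtain ⟨x, y, z, hxy, hxz, hyz, hx⟩ := h3
        have h18 := eighteen_le_card_triangles3 D huv huw hvw hab hac hbc ha hxy hxz hyz hx
        have h12 := third_triangle_bound D hK hk (by omega) huv huw hvw hab hac hbc ha hxy hxz hyz hx
        exact stability_of_triangle_bounds_seven' D hK hk (by omega)
      · have hS : ∀ x y z, D.Adj x y → D.Adj x z → D.Adj y z →
            x = u ∨ x = v ∨ x = w ∨ x = a ∨ x = b ∨ x = c := by
          intro x y z h1 h2 h3'
          by_contra hx
          exact h3 ⟨x, y, z, h1, h2, h3', hx⟩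
        exact stability_two_triangles_seven D hK hk hm huv huw hvw hab hac hbc ha hS

/-- **THE CELL `(7, 11)` IS EXACT:** the `K₄⁻`-free cherry maximum with `11` edges on `7` vertices is `25`
(`2 · 25 = 50`), by `K_{3,4}` minus an edge. -/
theorem cell_seven_eleven :
    (∀ (D : SimpleGraph (Fin 7)) [DecidableRel D.Adj], K4mFree D →
        D.edgeFinset.card = 11 → 2 * cherries D ≤ 50) ∧
      ∃ (D : SimpleGraph (Fin 7)) (_ : DecidableRel D.Adj), K4mFree D ∧
        D.edgeFinset.card = 11 ∧ 2 * cherries D = 50 := by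
  refine ⟨fun D _ hK hD => ?_, bipMinus 7 3, inferInstance, k4mFree_bipMinus 7 3,
    by have := card_edges_bipMinus 7 3 (by norm_num) (by norm_num); omega, ?_⟩
  · have hnot : ¬ ∃ A : Finset (Fin 7), ∀ x y, D.Adj x y ↔ Xor (x ∈ A) (y ∈ A) := by
      rintro ⟨A, hA⟩
      have h := card_edges_eq_of_complete_bipartite D A hA
      rw [Fintype.card_fin, hD] at h
      have hc : A.card ≤ 7 := by have := card_le_univ A; rw [Fintype.card_fin] at this; exact this
      have key : ∀ n, n ≤ 7 → 11 ≠ n * (7 - n) := by decide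
      exact key A.card hc h
    have h := cell_seven_eleven_stability D hK (Fintype.card_fin 7) (by rw [Fintype.card_fin, hD]) hnot
    rw [← two_mul_cherries_add, sum_deg_eq, Fintype.card_fin, hD] at h
    omega
  · have h := two_mul_cherries_bipMinus 7 3 (by norm_num) (by norm_num)
    norm_num at h
    omega

/-- **ONE BELOW THE DIAGONAL, `K₄⁻`-FREE, EXACT, FOR EVERY `k ≥ 7`:** for `1 ≤ a < k` with
`m = a(k−a) − 1 ≥ 2k − 3` not of the form `a′(k − a′)`, the maximum of `2·Σ_v C(d(v), 2)` over `K₄⁻`-free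
graphs with `m` edges on `k` vertices is `(m − 1)(k − 2)`, attained by `K_{a,k−a}` minus an edge. -/
theorem one_below_diagonal_exact_seven (k a : ℕ) (hk : 7 ≤ k) (ha : 1 ≤ a) (hak : a < k)
    (hdense : 2 * k ≤ a * (k - a) - 1 + 3)
    (hm : ∀ a', a' ≤ k → a * (k - a) - 1 ≠ a' * (k - a')) :
    (∀ (D : SimpleGraph (Fin k)) [DecidableRel D.Adj], K4mFree D →
        D.edgeFinset.card = a * (k - a) - 1 → 2 * cherries D ≤ (a * (k - a) - 2) * (k - 2)) ∧
      ∃ (D : SimpleGraph (Fin k)) (_ : DecidableRel D.Adj), K4mFree D ∧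
        D.edgeFinset.card = a * (k - a) - 1 ∧ 2 * cherries D = (a * (k - a) - 2) * (k - 2) := by
  rcases Nat.lt_or_ge k 8 with h7 | h8
  · -- `k = 7`: only `a = 3, 4`, the cell `(7, 11)`
    have hk7 : k = 7 := by omega
    subst hk7
    have ha34 : a * (7 - a) = 12 := by
      interval_cases a <;> simp_all
    rw [ha34]
    have h := cell_seven_eleven
    exact ⟨fun D _ hK hD => h.1 D hK hD, h.2⟩
  · exact one_below_diagonal_exact_eight k a h8 ha hak hdense hm

end C047

end TriangleCap

end PercRepro
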